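import Summits.Langlands.Langlands.Theses.SteinbergWeightVelocity
import Literature.NumberTheory.GaloisRepresentations.FramedRepTwist

/-!
# Disproof of `WeightVelocity` (crux stmt-Langlands-13450) — findings

cdisprove work file (cycle 2, refuter-cdisprove-stmt-Langlands-13450-g2-0; cycle 1's file by
refuter-cdisprove-stmt-Langlands-13450-0 lives only as item evidence
`run/gate/evidence/stmt-Langlands-13450/20260815T224115Z-Disproof.lean` and is not readable from a
g2 seat — this file RECONSTRUCTS its conclusive parts (R1), (R2) and records why the kill cannot be
turned into a landed `¬ WeightVelocity`).

## Findings

* (R1, formal, sorry-free) `accessible_of_weightVelocity`: `WeightVelocity` forces, for every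
  datum in its setting, a refinement exponent `χ` such that `π` has at EVERY place `w ∣ p` a local
  component with `χ_w` an exponent of its Jacquet module (structure axiom
  `EigenvarietyResGLn.isJacquetExponent_of_isClassicalPointOf` applied to the conjunct
  `Ev.IsClassicalPointOf ι x π χ`).  The hypotheses of `WeightVelocity` constrain `π` only at the
  one place `v`; on paper a regular algebraic cuspidal `π` with `π_v` Steinberg and `π_w`
  SUPERCUSPIDAL at another `w ∣ p` (zero Jacquet module) exists — e.g. `n = 2`, `p = 5`,
  `K = ℚ(√11, i)` (CM quartic), `π = BC_{K/ℚ(√11)}(π_A)` for the modular (Freitas–Le Hung–Siksek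
  2015) elliptic curve `A/ℚ(√11)` with multiplicative reduction at `𝔭₁ ∣ 5` and potentially good
  reduction with `e = 6 ∤ 5 - 1` at `𝔭₂ ∣ 5`; sector `2·[K_v:ℚ_5] = 2 ≤ 4 = [K:ℚ]`;
  `ρ = V_5(A)|_{Γ_K}` irreducible.  Hence `WeightVelocity` is FALSE on paper:
  `weightVelocity_refuted_of_witness : InaccessibleSteinbergWitness → ¬ WeightVelocity`.
  Classification: refuted-misstated; repaired statement C′₁ = add, after the Steinberg-type
  hypothesis, `(hacc : ∀ w : PlacesOver K p, ∃ πw χw, π.1.HasLocalComponentAt w.1 πw.ρ ∧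
  IsJacquetExponent πw χw)`; the witness misses C′₁.
* (R2, formal, sorry-free; cycle-1 line rebuilt) the KPX package does not pin `Drig`:
  for every admissible `Reindexing` `Φ` of framed Galois representations (class-bijection,
  conj-equivariant, fixing `1`; non-trivial instance `Reindexing.twistSwap μ` = the twist
  `ρ ↦ ρ ⊗ μ` corrected on the two central points so that `1` stays fixed) the datum
  `reindex 𝓣 Φ` (`Drig := Drig ∘ Φ`, everything else unchanged) is again a `PhiGammaModuleRobba`
  and `isKPX_reindex : 𝓣.IsKPX d → (reindex 𝓣 Φ).IsKPX d`.  Since clause (i) of the crux fixes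
  `σ, η` BEFORE `∀ 𝔇`, `parameter_rigidity_of_weightVelocity`: `WeightVelocity` forces a
  representative `ρx` of `ρ` to have ONE parameter `P` both for `𝔇` and for the reindexed family,
  i.e. (`hasParameterAt_reindex_iff`) some model `rE` of `ρ|_{K_v}` AND some `Φ rE'` — e.g.
  `rE' ⊗ μ` — are trianguline with the same `ℚ̄_p`-valued parameter; false on paper for
  Steinberg-type `ρ|_{K_v}` (unique triangulation; twisting multiplies parameters by `μ ∘ Art`).
  Repair C′₂ = a normalisation predicate on `𝔇` (rank-one Artin normalisation `Drig η ≅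
  𝓡(η ∘ Art)`, twist compatibility, exactness) — definition requests; the witness `twistSwap μ`
  violates each.  (If instead the genuine data fail the typed `IsKPX`, no KPX family exists and
  clauses (i)–(ii) are vacuous: misstated either way.)
* (CANONICAL API, Literature, landed 2026-08-15T23:18Z while this cycle ran)
  `Literature/NumberTheory/GaloisRepresentations/PhiGammaModuleReindex.lean`:
  `FramedRep.Reindexing` / `ReindexingFamily` (constructors `dual`, `swap`, `single`, `twist`,
  `twistSwap`), `PhiGammaModuleData.reindex`, `PhiGammaModuleRobba.reindex`,
  `PhiGammaModuleRobba.IsKPX.reindex`, `FramedGaloisRep.hasParameterAt_reindex_iff`,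
  `FramedGaloisRep.hasParameterAt_reindexed_of_forall_isKPX`.  The (R2) section below is a
  self-contained mirror written before that file landed; new work should import the Literature
  API (it also has the contragredient reindexing `dual`, a second independent junk direction:
  under it clause (i) forces the ordered parameter to be invariant under `δ ↦ (δ_n⁻¹,…,δ_1⁻¹)`).
* (LANDED through the gate, `--supports stmt-Langlands-13450`)
  `Summits/Langlands/Langlands/Theorems/WeightVelocity/Negative/Accessibility.lean` (p69536,
  accepted: `weightVelocity_accessible`, `weightVelocity_false_of_inaccessible`) and
  `…/Negative/ReindexingKPX.lean` (p69771, accepted — async audit, it carries definitions: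
  `Reindexing`, `reindex`, `isKPX_reindex`, `parameter_rigidity_of_weightVelocity`, namespace
  `Summit.Langlands.Langlands.Theorems.WeightVelocityNegative`).
* (R4, paper remark for the planner's re-cut, not a kill; arithmetic machine-checked below:
  `rank_two_steinberg_never_critical`, `rank_three_critical_flag_iff`, `rank_three_critical_flag_iff'`)
  CRITICAL STEINBERG POINTS.  Once `Ev` is
  pinned to the genuine eigenvariety (`param x` = Hansen's `δ_x`), clause (i) AT `x` (forced by
  `x ∉ Z`, `Z` closed, with `σ, η` shared with the generic points near `x`) says that the unique
  triangulation of the Steinberg-type `ρ|_{K_v}` has its Hodge–Tate weights in the family's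
  (standard) order, i.e. that `x` is non-critical at `v` (KPX Thm 6.3.13: otherwise the parameter
  at `x` is the family's times non-trivial algebraic factors).  Weak admissibility of
  `D_st(ρ|_{K_v})` (single Jordan block `N`, slopes `s, s+1, …`, `(φ,N)`-stable subobjects
  `ker Nⁱ` only) FORCES this for `n = 2` (`k₂ ≤ s = (k₁+k₂-1)/2` is impossible), but NOT for
  `n = 3`: with gaps `a = k₂-k₁`, `b = k₃-k₂` the flag order `(k₂,k₁,k₃)` is admissible iff
  `b ≥ a + 3` and `(k₁,k₃,k₂)` iff `a ≥ b + 3` (e.g. weights `(0,2,13)`, `s = 4`); only the band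
  `|a - b| ≤ 2` is safe by admissibility alone.  Nothing in the crux's hypotheses controls the
  Hodge position of `ρ_π|_{K_v}`; a critical Steinberg `π` (a codimension ≥ 1 condition, so
  perhaps never realised by the countably many `π`) would falsify the INTENDED crux at `v`.
  Suggested side condition for the re-cut: `x` non-critical at `v` (saturation of the global
  triangulation at `x`), or state (i) only on `Pt ∖ Z` without requiring `x ∉ Z` and carry
  `x ∈ closure (Pt ∖ Z)` instead.
* (N, why no `¬ WeightVelocity` can be landed in the present tree) `WeightVelocity` is
  `∀ K … (π : CuspidalAutomorphicRepData n K hcpt), 2 ≤ n → …`, so `¬ WeightVelocity` is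
  `∃ K n hcpt π …` with a WITNESS `π`, i.e. an honest Borel–Jacquet cuspidal automorphic
  representation datum of `GL_n(𝔸_K)`, `n ≥ 2`: submodules `W' < W ≤ cuspFormsGL n K hcpt`
  (`AutomorphicRepsGL`), hence a NON-ZERO cusp form `φ` on `GL_n(𝔸_K)` — left `GL_n(K)`-invariant,
  archimedean-smooth (`ContDiff`), `K_∞`- and `Z(𝔤)`-finite, of moderate growth, with vanishing
  constant terms along every maximal parabolic (`CuspConditionGL`, integrals over fundamental
  domains of `𝔫_k(K)` in `𝔫_k(𝔸_K)`).  The tree constructs automorphic representation data only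
  for `GL_1` (`GLOneOfHeckeCharacterBJ.exists_automorphicRepData_detTwist_glOne`, `ℂ·(θ∘det)/⊥`);
  for `n ≥ 2` every occurrence of `CuspidalAutomorphicRepData` is a binder or sits under a
  named-fact hypothesis, and no cheap function qualifies (functions constant at infinity factor
  through `det` by strong approximation and have non-zero constant terms; `θ∘det` likewise).
  Moreover the witness must satisfy `π.1.IsRegularAlgebraic` (an infinitesimal-character
  condition).  So the item is Lean-undecidable today in BOTH directions (no eigenvariety is
  constructed either); the refutation is conditional on the witness package
  `InaccessibleSteinbergWitness` below, which is exactly what a future construction of one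
  regular algebraic cusp form over a CM field (with its local components at `p`) would discharge.
-/

namespace Summit.Langlands.Langlands.Cruxes.WeightVelocity.Disproof

open Summit.Langlands.Langlands.Theses.SteinbergWeightVelocity
open Literature.NumberTheory.Automorphic Literature.NumberTheory.GaloisRepresentations
open IsDedekindDomain NumberField

/-! ## The setting of the crux, as one predicate -/

/-- The hypotheses of `WeightVelocity` on a datum `(K, n, π, p, ι, ρ, v)`: `2 ≤ n`, `π` regular
algebraic, `ρ` semisimple and C-Satake-compatible with `π` at almost all places, `v ∣ p` in the
sector, `π_v` of Steinberg type for every local Langlands datum and local component. [folklore] -/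
def InSetting (K : Type) [Field K] [NumberField K] (n : ℕ)
    (hcpt : isCompact_glFiniteIntegralLevel n K) (π : CuspidalAutomorphicRepData n K hcpt)
    (p : ℕ) [Fact p.Prime] (ι : PadicAlgCl p ≃+* ℂ) (ρ : FramedGaloisRep K (PadicAlgCl p) n)
    (v : HeightOneSpectrum (𝓞 K)) : Prop :=
  2 ≤ n ∧ π.1.IsRegularAlgebraic ∧ ρ.toGaloisRep.IsSemisimple ∧
    (∀ᶠ w : HeightOneSpectrum (𝓞 K) in Filter.cofinite, ∀ α : Multiset ℂ,
      π.1.HasSatakeParamAt w α →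
        ρ.IsUnramifiedAt w ∧ ρ.HasFrobCharpolyAt w (arithFrobPolyOfSatake ι w.residueCard n α)) ∧
    (3 ≤ n ∨ 2 * (v.asIdeal.ramificationIdx ℤ * v.asIdeal.inertiaDeg ℤ) ≤ Module.finrank ℚ K) ∧
    (∀ (L : LocalLanglandsDatum (v.adicCompletion K))
      (πv : SmoothIrrep (Matrix.GeneralLinearGroup (Fin n) (v.adicCompletion K))),
      π.1.HasLocalComponentAt v πv.ρ → ((L.recGL n (IrrClass.mk πv)).out.1).N ^ (n - 1) ≠ 0)

/-! ## (R1) `WeightVelocity` forces accessibility of `π` at every place above `p` -/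

/-- **(R1)** `WeightVelocity` implies: in its setting, for every `v ∣ p` there is a refinement
exponent `χ` such that at EVERY `w ∣ p` the representation `π` has a local component whose
Jacquet module has exponent `χ_w` (through `Ev.IsClassicalPointOf ι x π χ` and the structure
axiom `isJacquetExponent_of_isClassicalPointOf`).  False on paper when `π_w` is supercuspidal at
some `w ∣ p`, `w ≠ v`. [folklore] -/
theorem accessible_of_weightVelocity (h : WeightVelocity) (K : Type) [Field K] [NumberField K]
    [IsCMField K] (n : ℕ) (hcpt : isCompact_glFiniteIntegralLevel n K)
    (π : CuspidalAutomorphicRepData n K hcpt) (p : ℕ) [Fact p.Prime] (ι : PadicAlgCl p ≃+* ℂ)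
    (ρ : FramedGaloisRep K (PadicAlgCl p) n) (v : HeightOneSpectrum (𝓞 K))
    (hv : ((p : ℕ) : 𝓞 K) ∈ v.asIdeal) (hS : InSetting K n hcpt π p ι ρ v) :
    ∃ χ : RefinementExponent K n p, ∀ w : PlacesOver K p,
      ∃ πw : SmoothIrrep (Matrix.GeneralLinearGroup (Fin n) (w.1.adicCompletion K)),
        π.1.HasLocalComponentAt w.1 πw.ρ ∧ IsJacquetExponent πw (χ w) := by
  obtain ⟨hn, hRA, hss, hcompat, hsec, hSt⟩ := hS
  obtain ⟨S, Ev, x, χ, σ, η, Z, hcl, -⟩ := h K n hcpt π hn hRA p ι ρ hss hcompat v hv hsec hSt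
  exact ⟨χ, fun w => Ev.isJacquetExponent_of_isClassicalPointOf hcl w⟩

/-- **The paper witness, as a Prop**: some datum in the setting of `WeightVelocity` has a place
`w ∣ p` at which NO local component of `π` has ANY Jacquet exponent (e.g. `π_w` supercuspidal:
`n = 2`, `p = 5`, `K = ℚ(√11, i)`, `π` the base change of the FLS-modular elliptic curve over
`ℚ(√11)` with multiplicative reduction at one prime above `5` and supercuspidal type `e = 6` at the
other).  Not constructible in the tree (no cusp form on `GL_n`, `n ≥ 2`, is). [folklore] -/
def InaccessibleSteinbergWitness : Prop :=
  ∃ (K : Type) (_ : Field K) (_ : NumberField K) (_ : IsCMField K) (n : ℕ)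
    (hcpt : isCompact_glFiniteIntegralLevel n K) (π : CuspidalAutomorphicRepData n K hcpt)
    (p : ℕ) (_ : Fact p.Prime) (ι : PadicAlgCl p ≃+* ℂ) (ρ : FramedGaloisRep K (PadicAlgCl p) n)
    (v : HeightOneSpectrum (𝓞 K)) (_ : ((p : ℕ) : 𝓞 K) ∈ v.asIdeal),
    InSetting K n hcpt π p ι ρ v ∧
      ∃ w : PlacesOver K p,
        ∀ πw : SmoothIrrep (Matrix.GeneralLinearGroup (Fin n) (w.1.adicCompletion K)),
          π.1.HasLocalComponentAt w.1 πw.ρ →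
            ∀ χw : (Fin n → (w.1.adicCompletion K)ˣ) →* ℂˣ, ¬ IsJacquetExponent πw χw

/-- **(R1, conditional refutation)** the paper witness kills the crux:
`InaccessibleSteinbergWitness → ¬ WeightVelocity`. [folklore] -/
theorem weightVelocity_refuted_of_witness (hW : InaccessibleSteinbergWitness) :
    ¬ WeightVelocity := by
  intro h
  obtain ⟨K, _, _, _, n, hcpt, π, p, _, ι, ρ, v, hv, hS, w, hw⟩ := hW
  obtain ⟨χ, hχ⟩ := accessible_of_weightVelocity h K n hcpt π p ι ρ v hv hS
  obtain ⟨πw, hloc, hJ⟩ := hχ w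
  exact hw πw hloc (χ w) hJ

/-! ## (R2) The KPX package is invariant under reindexing `Drig` -/

section R2

open Field

universe u v w

noncomputable section

section Swap

variable {F : Type u} [Field F] {E : Type v} [Field E] [TopologicalSpace E]

namespace Reindexing

open Classical in
/-- The transposition of two points of `FramedGaloisRep F E n` (used with both points fixed by
every change of frame). [folklore] -/
def swapPt {n : ℕ} (c x : FramedGaloisRep F E n) : FramedGaloisRep F E n :=
  if x = 1 then c else if x = c then 1 else x

/-- `swapPt c 1 = c`. [folklore] -/
theorem swapPt_one {n : ℕ} (c : FramedGaloisRep F E n) : swapPt c 1 = c := by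
  simp [swapPt]

/-- `swapPt c c = 1`. [folklore] -/
theorem swapPt_self {n : ℕ} (c : FramedGaloisRep F E n) : swapPt c c = 1 := by
  by_cases hc : c = 1 <;> simp [swapPt, hc]

/-- `swapPt c` fixes every other point. [folklore] -/
theorem swapPt_of_ne {n : ℕ} {c x : FramedGaloisRep F E n} (h1 : x ≠ 1) (hc : x ≠ c) :
    swapPt c x = x := by
  simp [swapPt, h1, hc]

/-- `swapPt c` is an involution. [folklore] -/
theorem swapPt_swapPt {n : ℕ} (c x : FramedGaloisRep F E n) : swapPt c (swapPt c x) = x := by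
  by_cases h1 : x = 1
  · subst h1; rw [swapPt_one, swapPt_self]
  by_cases hc : x = c
  · subst hc; rw [swapPt_self, swapPt_one]
  rw [swapPt_of_ne h1 hc, swapPt_of_ne h1 hc]

end Reindexing

end Swap

section Reindexing

variable {F : Type u} [Field F] {E : Type v} [Field E] [TopologicalSpace E] [IsTopologicalRing E]

/-- Conjugating by `1` does nothing. [folklore] -/
theorem conj_by_one {n : ℕ} (ρ : FramedGaloisRep F E n) : FramedRep.conj 1 ρ = ρ := by
  refine ContinuousMonoidHom.ext fun σ => ?_
  rw [FramedRep.conj_apply, inv_one, one_mul, mul_one]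

/-- Conjugating the trivial framed representation does nothing. [folklore] -/
theorem conj_one_rep {n : ℕ} (g : GL (Fin n) E) :
    FramedRep.conj g (1 : FramedGaloisRep F E n) = 1 := by
  refine ContinuousMonoidHom.ext fun σ => ?_
  rw [FramedRep.conj_apply, ContinuousMonoidHom.coe_one, Pi.one_apply, mul_one, mul_inv_cancel]

/-- `g⁻¹ (g ρ g⁻¹) g = ρ`. [folklore] -/
theorem conj_inv_conj {n : ℕ} (g : GL (Fin n) E) (ρ : FramedGaloisRep F E n) :
    FramedRep.conj g⁻¹ (FramedRep.conj g ρ) = ρ := by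
  refine ContinuousMonoidHom.ext fun σ => ?_
  simp only [FramedRep.conj_apply, inv_inv]
  group

/-- Twisting by a fixed character is injective. [folklore] -/
theorem twist_injective {n : ℕ} (μ : absoluteGaloisGroup F →ₜ* Eˣ) {ρ ρ' : FramedGaloisRep F E n}
    (h : ρ.twist μ = ρ'.twist μ) : ρ = ρ' := by
  rw [← FramedRep.twist_twist_inv ρ μ, h, FramedRep.twist_twist_inv]

/-- `(ρ ⊗ μ⁻¹) ⊗ μ = ρ`. [folklore] -/
theorem twist_inv_twist {n : ℕ} (ρ : FramedGaloisRep F E n) (μ : absoluteGaloisGroup F →ₜ* Eˣ) :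
    (ρ.twist μ⁻¹).twist μ = ρ := by
  rw [FramedRep.twist_twist, mul_inv_cancel, FramedRep.twist_one]

variable (F E) in
/-- An **admissible reindexing** of framed `p`-adic Galois representations of `Γ_F` over `E`:
a self-map `Φ` of `FramedGaloisRep F E n` for every `n` which (a) is equivariant for changes of
frame up to a change of frame, (b) is injective and (c) surjective on conjugacy classes, and
(d) fixes the trivial representation.  These are EXACTLY the properties of `ρ ↦ D_rig(ρ)` that the
axioms of `PhiGammaModuleData` / `PhiGammaModuleRobba.IsKPX` record, so `Drig ∘ Φ` satisfies them
again (`reindexData`, `isKPX_reindex`). [folklore] -/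
structure Reindexing where
  /-- The self-map, rank by rank. -/
  Φ : ∀ {n : ℕ}, FramedGaloisRep F E n → FramedGaloisRep F E n
  /-- Equivariance up to a change of frame. -/
  conj : ∀ {n : ℕ} (g : GL (Fin n) E) (ρ : FramedGaloisRep F E n),
    ∃ g' : GL (Fin n) E, Φ (FramedRep.conj g ρ) = FramedRep.conj g' (Φ ρ)
  /-- Injectivity on conjugacy classes. -/
  inj : ∀ {n : ℕ} (ρ ρ' : FramedGaloisRep F E n) (g : GL (Fin n) E),
    Φ ρ' = FramedRep.conj g (Φ ρ) → ∃ g' : GL (Fin n) E, ρ' = FramedRep.conj g' ρ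
  /-- Surjectivity on conjugacy classes. -/
  surj : ∀ {n : ℕ} (ρ₀ : FramedGaloisRep F E n),
    ∃ (ρ : FramedGaloisRep F E n) (g : GL (Fin n) E), Φ ρ = FramedRep.conj g ρ₀
  /-- The trivial representation is fixed. -/
  one : ∀ n : ℕ, Φ (1 : FramedGaloisRep F E n) = 1

namespace Reindexing

variable (F E) in
/-- The identity reindexing. [folklore] -/
protected def id : Reindexing F E where
  Φ := fun ρ => ρ
  conj := fun g _ => ⟨g, rfl⟩
  inj := fun _ _ g h => ⟨g, h⟩
  surj := fun ρ₀ => ⟨ρ₀, 1, (conj_by_one ρ₀).symm⟩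
  one := fun _ => rfl

/-- `swapPt c` commutes with changes of frame when `c` is fixed by them. [folklore] -/
theorem swapPt_conj {n : ℕ} {c : FramedGaloisRep F E n} (hcen : ∀ g : GL (Fin n) E, FramedRep.conj g c = c)
    (g : GL (Fin n) E) (x : FramedGaloisRep F E n) :
    swapPt c (FramedRep.conj g x) = FramedRep.conj g (swapPt c x) := by
  by_cases h1 : x = 1
  · subst h1; rw [conj_one_rep, swapPt_one, hcen]
  by_cases hc : x = c
  · subst hc; rw [hcen, swapPt_self, conj_one_rep]
  have h1' : FramedRep.conj g x ≠ 1 := fun h => h1 (by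
    rw [← conj_inv_conj g x, h, conj_one_rep])
  have hc' : FramedRep.conj g x ≠ c := fun h => hc (by
    rw [← conj_inv_conj g x, h, hcen])
  rw [swapPt_of_ne h1' hc', swapPt_of_ne h1 hc]

/-- The scalar representation `μ · 1` is fixed by every change of frame. [folklore] -/
theorem conj_one_twist {n : ℕ} (μ : absoluteGaloisGroup F →ₜ* Eˣ) (g : GL (Fin n) E) :
    FramedRep.conj g ((1 : FramedGaloisRep F E n).twist μ) = (1 : FramedGaloisRep F E n).twist μ := by
  rw [FramedRep.conj_twist, conj_one_rep]

/-- **The twist-swap reindexing** attached to a continuous character `μ : Γ_F → Eˣ`: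
`ρ ↦ ρ ⊗ μ`, corrected by the transposition of the two central points `1` and `μ·1` so that the
trivial representation stays fixed.  On every `ρ ∉ {1, μ⁻¹·1}` it IS the twist `ρ ⊗ μ`
(`twistSwap_apply`). [folklore] -/
def twistSwap (μ : absoluteGaloisGroup F →ₜ* Eˣ) : Reindexing F E where
  Φ := fun ρ => swapPt ((1 : FramedGaloisRep F E _).twist μ) (ρ.twist μ)
  conj := fun g ρ => ⟨g, by
    rw [← FramedRep.conj_twist, swapPt_conj (conj_one_twist μ)]⟩
  inj := fun ρ ρ' g h => ⟨g, by
    have h' := congrArg (swapPt ((1 : FramedGaloisRep F E _).twist μ)) h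
    rw [swapPt_swapPt, ← swapPt_conj (conj_one_twist μ), swapPt_swapPt,
      FramedRep.conj_twist] at h'
    exact twist_injective μ h'⟩
  surj := fun ρ₀ => ⟨(swapPt ((1 : FramedGaloisRep F E _).twist μ) ρ₀).twist μ⁻¹, 1, by
    rw [twist_inv_twist, swapPt_swapPt, conj_by_one]⟩
  one := fun n => by
    show swapPt ((1 : FramedGaloisRep F E n).twist μ) ((1 : FramedGaloisRep F E n).twist μ) = 1
    exact swapPt_self _

/-- Off the two exceptional points `1` and `μ⁻¹ · 1`, `twistSwap μ` is the twist by `μ`.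
[folklore] -/
theorem twistSwap_apply {n : ℕ} (μ : absoluteGaloisGroup F →ₜ* Eˣ) {ρ : FramedGaloisRep F E n}
    (h1 : ρ ≠ 1) (hμ : ρ ≠ (1 : FramedGaloisRep F E n).twist μ⁻¹) :
    (twistSwap μ).Φ ρ = ρ.twist μ := by
  show swapPt ((1 : FramedGaloisRep F E n).twist μ) (ρ.twist μ) = ρ.twist μ
  refine swapPt_of_ne (fun h => hμ ?_) (fun h => h1 (twist_injective μ h))
  rw [← FramedRep.twist_twist_inv ρ μ, h]

end Reindexing

/-! ### Reindexed `(φ, Γ)`-module data -/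

variable {p : ℕ} [Fact p.Prime] [TopologicalSpace F]

/-- **Reindexing the `D_rig` of a `(φ, Γ_F)`-module datum**: same ring, same rank-one objects,
`Drig := Drig ∘ Φ`.  All axioms of `PhiGammaModuleData` are preserved. [folklore] -/
def reindexData (𝔇 : PhiGammaModuleData.{u, v, w} p F E) (Φ : Reindexing F E) :
    PhiGammaModuleData.{u, v, w} p F E where
  ring := 𝔇.ring
  smul_eq_self := 𝔇.smul_eq_self
  Drig := fun ρ => 𝔇.Drig (Φ.Φ ρ)
  Drig_matGamma_eq_one := fun ρ σ h => 𝔇.Drig_matGamma_eq_one (Φ.Φ ρ) σ h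
  Drig_conj := fun g ρ => by
    obtain ⟨g', hg'⟩ := Φ.conj g ρ
    show (𝔇.Drig (Φ.Φ ρ)).IsIso (𝔇.Drig (Φ.Φ (FramedRep.conj g ρ)))
    rw [hg']
    exact 𝔇.Drig_conj g' (Φ.Φ ρ)
  Drig_injective := fun ρ ρ' h => by
    obtain ⟨g, hg⟩ := 𝔇.Drig_injective (Φ.Φ ρ) (Φ.Φ ρ') h
    exact Φ.inj ρ ρ' g hg
  Drig_one := fun n => by
    show (𝔇.Drig (Φ.Φ 1)).IsIso _
    rw [Φ.one]
    exact 𝔇.Drig_one n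
  charMod := 𝔇.charMod
  charMod_matGamma_eq_one := 𝔇.charMod_matGamma_eq_one
  charMod_one := 𝔇.charMod_one
  charMod_injective := 𝔇.charMod_injective
  Drig_rank_one := fun η => 𝔇.Drig_rank_one (Φ.Φ η)

/-- Reindexing keeps the ring. [folklore] -/
@[simp] theorem reindexData_ring (𝔇 : PhiGammaModuleData.{u, v, w} p F E) (Φ : Reindexing F E) :
    (reindexData 𝔇 Φ).ring = 𝔇.ring := rfl

/-- Reindexing replaces `Drig` by `Drig ∘ Φ`. [folklore] -/
@[simp] theorem reindexData_Drig (𝔇 : PhiGammaModuleData.{u, v, w} p F E) (Φ : Reindexing F E)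
    {n : ℕ} (ρ : FramedGaloisRep F E n) : (reindexData 𝔇 Φ).Drig ρ = 𝔇.Drig (Φ.Φ ρ) := rfl

/-- Reindexing keeps the rank-one objects. [folklore] -/
@[simp] theorem reindexData_charMod (𝔇 : PhiGammaModuleData.{u, v, w} p F E) (Φ : Reindexing F E)
    (δ : Fˣ →ₜ* Eˣ) : (reindexData 𝔇 Φ).charMod δ = 𝔇.charMod δ := rfl

/-- **Triangulinity is transported**: `ρ` is trianguline with parameter `δ` for the reindexed
datum iff `Φ ρ` is for the original one. [folklore] -/
theorem isTriangulineWith_reindexData_iff (𝔇 : PhiGammaModuleData.{u, v, w} p F E)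
    (Φ : Reindexing F E) {n : ℕ} (ρ : FramedGaloisRep F E n) (δ : Fin n → (Fˣ →ₜ* Eˣ)) :
    ρ.IsTriangulineWith (reindexData 𝔇 Φ) δ ↔ (Φ.Φ ρ).IsTriangulineWith 𝔇 δ :=
  Iff.rfl

/-- **Reindexing the enriched datum** (`PhiGammaModuleRobba`): only `Drig` changes. [folklore] -/
def reindex (𝓣 : PhiGammaModuleRobba.{u, v, w} p F E) (Φ : Reindexing F E) :
    PhiGammaModuleRobba.{u, v, w} p F E where
  toPhiGammaModuleData := reindexData 𝓣.toPhiGammaModuleData Φ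
  topR := 𝓣.topR
  topRingR := 𝓣.topRingR
  continuous_frob := 𝓣.continuous_frob
  continuous_act := 𝓣.continuous_act
  continuous_orbit := 𝓣.continuous_orbit
  gen := 𝓣.gen
  dense_gen := 𝓣.dense_gen
  homToH1 := 𝓣.homToH1
  IsEtale := 𝓣.IsEtale

/-- The underlying datum of the reindexed enriched datum. [folklore] -/
@[simp] theorem reindex_toPhiGammaModuleData (𝓣 : PhiGammaModuleRobba.{u, v, w} p F E)
    (Φ : Reindexing F E) :
    (reindex 𝓣 Φ).toPhiGammaModuleData = reindexData 𝓣.toPhiGammaModuleData Φ := rfl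

/-- `Drig` of the reindexed enriched datum. [folklore] -/
@[simp] theorem reindex_Drig (𝓣 : PhiGammaModuleRobba.{u, v, w} p F E) (Φ : Reindexing F E)
    {n : ℕ} (ρ : FramedGaloisRep F E n) : (reindex 𝓣 Φ).Drig ρ = 𝓣.Drig (Φ.Φ ρ) := rfl

/-- **(R2) The KPX package does not see the reindexing**: `IsKPX d` for `𝓣` implies `IsKPX d`
for `reindex 𝓣 Φ`, for EVERY admissible reindexing `Φ` (e.g. `twistSwap μ`).  So `IsKPX`
does not pin `Drig` down in any rank `≥ 2` (in rank one only up to `Drig_rank_one`'s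
unnamed `δ`). [folklore] -/
theorem isKPX_reindex {𝓣 : PhiGammaModuleRobba.{u, v, w} p F E} {d : ℕ} (h : 𝓣.IsKPX d)
    (Φ : Reindexing F E) : (reindex 𝓣 Φ).IsKPX d := by
  obtain ⟨hL, hR, hC, hCFT, hE1, hE2, hE3⟩ := h
  refine ⟨hL, hR, hC, hCFT, fun n ρ => hE1 n (Φ.Φ ρ), hE2, fun n D hcyc hcont het => ?_⟩
  obtain ⟨ρ₀, hρ₀⟩ := hE3 n D hcyc hcont het
  obtain ⟨ρ, g, hg⟩ := Φ.surj ρ₀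
  refine ⟨ρ, ?_⟩
  show (𝓣.Drig (Φ.Φ ρ)).IsIso D
  rw [hg]
  exact (𝓣.Drig_conj g ρ₀).symm.trans hρ₀

end Reindexing

/-! ### (R2) Consequence for the crux: parameter rigidity under every admissible reindexing -/

section Crux

open Summit.Langlands.Langlands.Theses.SteinbergWeightVelocity
open Literature.NumberTheory.Automorphic IsDedekindDomain NumberField

/-- Unfolding: a parameter at `v` for the REINDEXED family is a model `rE` of `ρ|_{Γ_{K_v}}` whose
image `Φ rE` under the reindexing (e.g. `rE ⊗ μ`) is trianguline with that parameter in the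
ORIGINAL theory. [folklore] -/
theorem hasParameterAt_reindex_iff {K : Type} [Field K] [NumberField K] {p : ℕ} [Fact p.Prime]
    {n : ℕ} (v : HeightOneSpectrum (𝓞 K))
    (𝔇 : ∀ (E₀ : IntermediateField ℚ_[p] (PadicAlgCl p)), FiniteDimensional ℚ_[p] E₀ →
      PhiGammaModuleRobba.{0, 0, 0} p (v.adicCompletion K) E₀)
    (Φ : ∀ (E₀ : IntermediateField ℚ_[p] (PadicAlgCl p)), FiniteDimensional ℚ_[p] E₀ →
      Reindexing (v.adicCompletion K) E₀)
    (ρ : FramedGaloisRep K (PadicAlgCl p) n)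
    (P : Fin n → ((v.adicCompletion K)ˣ →ₜ* (PadicAlgCl p)ˣ)) :
    ρ.HasParameterAt v (fun E₀ hE₀ => (reindex (𝔇 E₀ hE₀) (Φ E₀ hE₀)).toPhiGammaModuleData) P ↔
      ∃ (E₀ : IntermediateField ℚ_[p] (PadicAlgCl p)) (hE₀ : FiniteDimensional ℚ_[p] E₀)
        (rE : FramedGaloisRep (v.adicCompletion K) E₀ n)
        (δE : Fin n → ((v.adicCompletion K)ˣ →ₜ* E₀ˣ)),
        HasQlModel (ρ.toLocal v) E₀ rE ∧
          ((Φ E₀ hE₀).Φ rE).IsTriangulineWith (𝔇 E₀ hE₀).toPhiGammaModuleData δE ∧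
            ∀ (i : Fin n) (x : (v.adicCompletion K)ˣ),
              ((P i x : (PadicAlgCl p)ˣ) : PadicAlgCl p) = algebraMap E₀ (PadicAlgCl p) (δE i x : E₀ˣ) :=
  Iff.rfl

/-- **(R2) Parameter rigidity forced by `WeightVelocity`.**  In the setting of the crux, for every
KPX family `𝔇` and EVERY family `Φ` of admissible reindexings, clause (i) at the point `x` (applied
to `𝔇` and to the reindexed family, which is again KPX by `isKPX_reindex`) yields a representative
`ρx` of `ρ` and ONE parameter `P = (δ_x · η) ∘ σ` such that both `ρx` and — through
`hasParameterAt_reindex_iff` — the reindexed models `Φ rE` (e.g. `rE ⊗ μ` for `twistSwap μ`) are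
trianguline with the SAME `ℚ̄_p`-valued parameter `P`.  On paper this is false at the route's
own points: `ρ|_{K_v}` of Steinberg type has a unique triangulation, and the parameters of
`rE ⊗ μ` are those of `rE` multiplied by `μ ∘ Art` (`μ ≠ 1` quadratic, so `E₀`-valued for every
`E₀`).  Classification: refuted-misstated; repair C′₂ = a normalisation predicate on `𝔇`
(rank-one Artin normalisation, twist compatibility, exactness of `Drig`). [folklore] -/
theorem parameter_rigidity_of_weightVelocity (h : WeightVelocity) (K : Type) [Field K]
    [NumberField K] [IsCMField K] (n : ℕ) (hcpt : isCompact_glFiniteIntegralLevel n K)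
    (π : CuspidalAutomorphicRepData n K hcpt) (hn : 2 ≤ n) (hRA : π.1.IsRegularAlgebraic)
    (p : ℕ) [Fact p.Prime] (ι : PadicAlgCl p ≃+* ℂ) (ρ : FramedGaloisRep K (PadicAlgCl p) n)
    (hss : ρ.toGaloisRep.IsSemisimple)
    (hcompat : ∀ᶠ w : HeightOneSpectrum (𝓞 K) in Filter.cofinite, ∀ α : Multiset ℂ,
      π.1.HasSatakeParamAt w α →
        ρ.IsUnramifiedAt w ∧ ρ.HasFrobCharpolyAt w (arithFrobPolyOfSatake ι w.residueCard n α))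
    (v : HeightOneSpectrum (𝓞 K)) (hv : ((p : ℕ) : 𝓞 K) ∈ v.asIdeal)
    (hsec : 3 ≤ n ∨ 2 * (v.asIdeal.ramificationIdx ℤ * v.asIdeal.inertiaDeg ℤ) ≤ Module.finrank ℚ K)
    (hSt : ∀ (L : LocalLanglandsDatum (v.adicCompletion K))
      (πv : SmoothIrrep (Matrix.GeneralLinearGroup (Fin n) (v.adicCompletion K))),
      π.1.HasLocalComponentAt v πv.ρ → ((L.recGL n (IrrClass.mk πv)).out.1).N ^ (n - 1) ≠ 0)
    (𝔇 : ∀ (E₀ : IntermediateField ℚ_[p] (PadicAlgCl p)), FiniteDimensional ℚ_[p] E₀ →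
      PhiGammaModuleRobba.{0, 0, 0} p (v.adicCompletion K) E₀)
    (h𝔇 : ∀ (E₀ : IntermediateField ℚ_[p] (PadicAlgCl p)) (hE₀ : FiniteDimensional ℚ_[p] E₀),
      (𝔇 E₀ hE₀).IsKPX (v.asIdeal.ramificationIdx ℤ * v.asIdeal.inertiaDeg ℤ))
    (Φ : ∀ (E₀ : IntermediateField ℚ_[p] (PadicAlgCl p)), FiniteDimensional ℚ_[p] E₀ →
      Reindexing (v.adicCompletion K) E₀) :
    ∃ (ρx : FramedGaloisRep K (PadicAlgCl p) n)
      (P : Fin n → ((v.adicCompletion K)ˣ →ₜ* (PadicAlgCl p)ˣ)),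
      (∃ g : GL (Fin n) (PadicAlgCl p), FramedRep.conj g ρx = ρ) ∧
        ρx.HasParameterAt v (fun E₀ hE₀ => (𝔇 E₀ hE₀).toPhiGammaModuleData) P ∧
          ρx.HasParameterAt v
            (fun E₀ hE₀ => (reindex (𝔇 E₀ hE₀) (Φ E₀ hE₀)).toPhiGammaModuleData) P := by
  obtain ⟨S, Ev, x, χ, σ, η, Z, -, -, hconj, -, hxZ, hi, -⟩ :=
    h K n hcpt π hn hRA p ι ρ hss hcompat v hv hsec hSt
  exact ⟨Ev.galoisRep x, fun j => Ev.param x ⟨v, hv⟩ (σ j) * η j, hconj, hi 𝔇 h𝔇 x hxZ,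
    hi (fun E₀ hE₀ => reindex (𝔇 E₀ hE₀) (Φ E₀ hE₀)) (fun E₀ hE₀ => isKPX_reindex (h𝔇 E₀ hE₀) _)
      x hxZ⟩

end Crux

end

end R2

/-! ## (R4) Admissibility arithmetic: when can a Steinberg-type point be critical? -/

section R4

/-- **(R4, rank 2)** For a Steinberg-type filtered `(φ, N)`-module of rank `2` (jumps `k₁ < k₂`,
slopes `s, s+1`, `t_H = t_N`: `k₁ + k₂ = 2s + 1`) the critical flag order is NOT weakly
admissible: `k₂ ≤ s` is impossible.  So rank-2 Steinberg-type representations are never critical.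
[folklore] -/
theorem rank_two_steinberg_never_critical (k₁ k₂ : ℤ) (s : ℚ) (hk : k₁ < k₂)
    (hsum : (k₁ : ℚ) + k₂ = 2 * s + 1) : ¬ ((k₂ : ℚ) ≤ s) := by
  intro h
  have hk' : (k₁ : ℚ) + 1 ≤ k₂ := by exact_mod_cast hk
  linarith

/-- **(R4, rank 3)** For rank `3` (jumps `k₁ < k₂ < k₃`, slopes `s, s+1, s+2`,
`k₁ + k₂ + k₃ = 3s + 3`) the flag order `(k₂, k₁, k₃)` (critical at the first step) satisfies the
two weak-admissibility inequalities `t_H(ker N) ≤ t_N(ker N)` and `t_H(ker N²) ≤ t_N(ker N²)` iff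
`2k₂ + 3 ≤ k₁ + k₃`, i.e. iff the gaps `a = k₂ - k₁`, `b = k₃ - k₂` satisfy `b ≥ a + 3`. [folklore] -/
theorem rank_three_critical_flag_iff (k₁ k₂ k₃ : ℤ) (s : ℚ) (h12 : k₁ < k₂) (h23 : k₂ < k₃)
    (hsum : (k₁ : ℚ) + k₂ + k₃ = 3 * s + 3) :
    ((k₂ : ℚ) ≤ s ∧ (k₂ : ℚ) + k₁ ≤ 2 * s + 1) ↔ 2 * k₂ + 3 ≤ k₁ + k₃ := by
  have h12' : (k₁ : ℚ) + 1 ≤ k₂ := by exact_mod_cast h12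
  have h23' : (k₂ : ℚ) + 1 ≤ k₃ := by exact_mod_cast h23
  constructor
  · rintro ⟨h1, -⟩
    have : (2 : ℚ) * k₂ + 3 ≤ k₁ + k₃ := by linarith
    exact_mod_cast this
  · intro h
    have h' : (2 : ℚ) * k₂ + 3 ≤ k₁ + k₃ := by exact_mod_cast h
    constructor <;> linarith

/-- **(R4, example)** weights `(0, 2, 13)`, `s = 4`: the critical flag `(k₂, k₁, k₃)` is weakly
admissible (`2 ≤ 4`, `2 + 0 ≤ 9`, and `t_H = 15 = 3·4 + 3`). [folklore] -/
example : ((2 : ℚ) ≤ 4 ∧ (2 : ℚ) + 0 ≤ 2 * 4 + 1) ∧ ((0 : ℚ) + 2 + 13 = 3 * 4 + 3) := by norm_num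

/-- **(R4, symmetric case)** the flag order `(k₁, k₃, k₂)` (critical at the second step) is
admissible iff `k₁ + k₃ + 3 ≤ 2k₂`, i.e. `a ≥ b + 3`. [folklore] -/
theorem rank_three_critical_flag_iff' (k₁ k₂ k₃ : ℤ) (s : ℚ) (h12 : k₁ < k₂) (h23 : k₂ < k₃)
    (hsum : (k₁ : ℚ) + k₂ + k₃ = 3 * s + 3) :
    ((k₁ : ℚ) ≤ s ∧ (k₁ : ℚ) + k₃ ≤ 2 * s + 1) ↔ k₁ + k₃ + 3 ≤ 2 * k₂ := by
  have h12' : (k₁ : ℚ) + 1 ≤ k₂ := by exact_mod_cast h12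
  have h23' : (k₂ : ℚ) + 1 ≤ k₃ := by exact_mod_cast h23
  constructor
  · rintro ⟨-, h2⟩
    have : (k₁ : ℚ) + k₃ + 3 ≤ 2 * k₂ := by linarith
    exact_mod_cast this
  · intro h
    have h' : (k₁ : ℚ) + k₃ + 3 ≤ 2 * k₂ := by exact_mod_cast h
    constructor <;> linarith

end R4

end Summit.Langlands.Langlands.Cruxes.WeightVelocity.Disproof
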